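import Summits.QuantumFields.YangMills.Cruxes.SoftKernelBoostCovariance.Lines.TwoGapPlanarCone

/-!
# Special case (s) of the rung `TwoGapPlanarCone`: member 0 of `PlanarConeRung` is the floor

FORWARD G1 witness-by-name: the graded family `PlanarConeRung` has member `0` definitionally equal to
the parent's proved crux `MirrorModularBoosts.PlanarSpectralCone` (stmt-QuantumFields-9664), and the
seed theorem `PositivityDiscToOperatorCone.PlanarSpectralCone_of` proves it. Member `1` is the rung.
-/

namespace Summit.QuantumFields.YangMills.Cruxes.SoftKernelBoostCovariance.TwoGapPlanarCone

/-- Member 0 of the family is the floor, by name. -/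
example : PlanarConeRung 0 = Summit.QuantumFields.YangMills.Theses.MirrorModularBoosts.PlanarSpectralCone :=
  rfl

/-- Member 1 of the family is the rung. -/
example : PlanarConeRung 1 = TwoGapPlanarCone := rfl

/-- The special case rung 0 holds: witnessed by the seed theorem (stmt-QuantumFields-9664). -/
theorem planarConeRung_zero_holds : PlanarConeRung 0 :=
  Summit.QuantumFields.YangMills.Cruxes.PlanarSpectralCone.PositivityDiscToOperatorCone.PlanarSpectralCone_of

end Summit.QuantumFields.YangMills.Cruxes.SoftKernelBoostCovariance.TwoGapPlanarCone
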